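import Mathlib
import Literature.Analysis.FunctionSpaces.MinlosSazonovBound
import Summits.RiemannHypothesis.RiemannHypothesis.Theorems.PfPersistenceF2PlantedIndex
import Summits.RiemannHypothesis.RiemannHypothesis.Theorems.PfPersistenceF2SplitDeflation

/-!
# F2 / PURE PLANTS — the negativity criterion of a planted quadruple (G-SPLIT-X kernel, ruling A345 (R2))

pub-rhpf fake seat 2, generation 6.  **Mechanism / rigidity campaign; no RH claims.**  Elementary, RH-free linear
algebra over an arbitrary finite index type; it makes the sentences labelled DERIVED in FAKES.md §2.10 ("pure plants
within reach") rest on kernel-checked lemmas BY NAME, with the certified window DATA entering only as hypotheses.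

OBJECT.  The served L-datum `planted {delta: η, gamma0: γ, weight: m}` adds to ζ the quadruple of zeros
`½ ± η ± iγ`.  On either parity block of the windowed Weil form this is the rank-two edit
`D = Q + 4m p pᵀ − 4m q qᵀ`  (`p + iq` = the window's test vector at `η + iγ`; `m ≥ 0`), i.e. the form
`xᵀQx + 4m⟨p,x⟩² − 4m⟨q,x⟩²` (`dotProduct_plantMatrix_mulVec`).

CRITERION (`plant_neg_iff`).  Let `Q ⪰ 0`, `m ≥ 0`, and let `y_p`, `y_q` be preimages, `Q y_p = p`, `Q y_q = q`
(think `Q⁻¹p`, `Q⁻¹q`; no inverse appears, so interval preimages are fine).  Put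
`A := ⟨y_p, p⟩`, `B := ⟨y_q, q⟩`, `C := ⟨y_p, q⟩` (`= pᵀQ⁻¹p, qᵀQ⁻¹q, pᵀQ⁻¹q`).  Then
`(∃ x, xᵀQx + 4m⟨p,x⟩² − 4m⟨q,x⟩² < 0) ↔ 1 < 4m · (B − 4m C² / (1 + 4m A))`.
The number `B̃ := B − 4mC²/(1+4mA)` is `qᵀ(Q + 4mppᵀ)⁻¹q` (Sherman–Morrison): the explicit vector
`y := y_q − (4mC/(1+4mA)) y_p` satisfies `(Q + 4mppᵀ) y = q` (`plantTilde_mulVec_smPreimage`) and `⟨y, q⟩ = B̃`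
(`smPreimage_dotProduct`); necessity is Cauchy–Schwarz in the `(Q + 4mppᵀ)`-form, sufficiency is the witness `x = y`.
Consequences used by the cell:
* `plant_threshold_iff`: with `q = η s` (the off-line deficit direction `s` at unit displacement) the block is negative
  somewhere iff `1 < 4 m η² B̃_s` — the THRESHOLD `η*(γ; w) = 1/(2√(m B̃_s))` of FAKES.md §2.10, monotone in `η`;
* `coupling_ge_trial`: `⟨q, z⟩² ≤ B̃ · (zᵀQz + 4m⟨p,z⟩²)` for every trial vector `z` — the FRAME LOWER BOUND
  `B̃ ≥ B̃_lo` (trial vectors in the span of ζ's bottom eigenvectors), hence `η* ≤ η*_up`.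
All statements are folklore (Schur complement / Sherman–Morrison / Cauchy–Schwarz); Mathlib's `Matrix.PosSemidef`.
-/

namespace Summit.RiemannHypothesis.RiemannHypothesis.Theorems.PfPersistenceF2PlantCriterion

open Matrix BigOperators Finset
open Literature.Analysis.FunctionSpaces.MinlosSazonov (sq_dotProduct_mulVec_le dotProduct_mulVec_comm)
open Summit.RiemannHypothesis.RiemannHypothesis.Theorems.PfPersistenceF2PlantedIndex (vecMulVec_mulVec_eq)
open Summit.RiemannHypothesis.RiemannHypothesis.Theorems.PfPersistenceF2SplitDeflation (form_nonneg posSemidef_of_isSymm)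

variable {ι : Type*} [Fintype ι]

/-- Quadratic form of the planted block `Q + 4m ppᵀ − 4m qqᵀ`. -/
theorem dotProduct_plantMatrix_mulVec (Q : Matrix ι ι ℝ) (m : ℝ) (p q x : ι → ℝ) :
    x ⬝ᵥ (Q + (4 * m) • vecMulVec p p - (4 * m) • vecMulVec q q) *ᵥ x
      = x ⬝ᵥ Q *ᵥ x + 4 * m * (p ⬝ᵥ x) ^ 2 - 4 * m * (q ⬝ᵥ x) ^ 2 := by
  rw [sub_mulVec, add_mulVec, Matrix.smul_mulVec, Matrix.smul_mulVec, vecMulVec_mulVec_eq, vecMulVec_mulVec_eq,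
    dotProduct_sub, dotProduct_add, dotProduct_smul, dotProduct_smul, dotProduct_smul, dotProduct_smul,
    dotProduct_comm x p, dotProduct_comm x q]
  simp only [smul_eq_mul]
  ring

/-- Quadratic form of the stiffened block `Q̃ := Q + 4m ppᵀ`. -/
theorem dotProduct_tildeMatrix_mulVec (Q : Matrix ι ι ℝ) (m : ℝ) (p x : ι → ℝ) :
    x ⬝ᵥ (Q + (4 * m) • vecMulVec p p) *ᵥ x = x ⬝ᵥ Q *ᵥ x + 4 * m * (p ⬝ᵥ x) ^ 2 := by
  rw [add_mulVec, Matrix.smul_mulVec, vecMulVec_mulVec_eq, dotProduct_add, dotProduct_smul, dotProduct_smul,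
    dotProduct_comm x p]
  simp only [smul_eq_mul]
  ring

omit [Fintype ι] in
/-- A real `PosSemidef` matrix is symmetric. -/
theorem isSymm_of_posSemidef {Q : Matrix ι ι ℝ} (hQ : Q.PosSemidef) : Q.IsSymm := by
  have h := hQ.1
  rw [IsHermitian, conjTranspose_eq_transpose_of_trivial] at h
  exact h

/-- `Q ⪰ 0`, `0 ≤ c` ⇒ `Q + c ppᵀ ⪰ 0`. [folklore] -/
theorem posSemidef_add_smul_vecMulVec {Q : Matrix ι ι ℝ} (hQ : Q.PosSemidef) {c : ℝ} (hc : 0 ≤ c)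
    (p : ι → ℝ) : (Q + c • vecMulVec p p).PosSemidef := by
  have hS := isSymm_of_posSemidef hQ
  refine posSemidef_of_isSymm ?_ ?_
  · have h1 : (vecMulVec p p).IsSymm := by
      unfold Matrix.IsSymm
      ext i j
      simp [vecMulVec_apply, mul_comm]
    unfold Matrix.IsSymm at hS h1 ⊢
    rw [transpose_add, transpose_smul, hS, h1]
  · intro v
    rw [add_mulVec, Matrix.smul_mulVec, vecMulVec_mulVec_eq, dotProduct_add, dotProduct_smul, dotProduct_smul,
      dotProduct_comm v p]
    simp only [smul_eq_mul]
    nlinarith [form_nonneg hQ v, sq_nonneg (p ⬝ᵥ v), mul_nonneg hc (sq_nonneg (p ⬝ᵥ v))]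

section ShermanMorrison

variable {Q : Matrix ι ι ℝ} {m : ℝ} {p q y_p y_q : ι → ℝ}

/-- With `Q` symmetric and `Q y_p = p`, `Q y_q = q`: `⟨p, y_q⟩ = ⟨y_p, q⟩` (both equal `y_pᵀ Q y_q`). -/
theorem dotProduct_preimage_comm (hQ : Q.IsHermitian) (hp : Q *ᵥ y_p = p) (hq : Q *ᵥ y_q = q) :
    p ⬝ᵥ y_q = y_p ⬝ᵥ q := by
  calc p ⬝ᵥ y_q = (Q *ᵥ y_p) ⬝ᵥ y_q := by rw [hp]
    _ = y_q ⬝ᵥ Q *ᵥ y_p := dotProduct_comm _ _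
    _ = y_p ⬝ᵥ Q *ᵥ y_q := dotProduct_mulVec_comm hQ _ _
    _ = y_p ⬝ᵥ q := by rw [hq]

/-- **Sherman–Morrison preimage.**  If `Q y_p = p`, `Q y_q = q` and `1 + 4mA ≠ 0` (`A := ⟨y_p, p⟩`), then
`y := y_q − (4mC/(1+4mA)) y_p` (`C := ⟨y_p, q⟩`) solves `(Q + 4m ppᵀ) y = q`. [folklore] -/
theorem plantTilde_mulVec_smPreimage (hQ : Q.IsHermitian) (hp : Q *ᵥ y_p = p) (hq : Q *ᵥ y_q = q)
    (h1 : 1 + 4 * m * (y_p ⬝ᵥ p) ≠ 0) :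
    (Q + (4 * m) • vecMulVec p p) *ᵥ (y_q - (4 * m * (y_p ⬝ᵥ q) / (1 + 4 * m * (y_p ⬝ᵥ p))) • y_p) = q := by
  have hpyq : p ⬝ᵥ y_q = y_p ⬝ᵥ q := dotProduct_preimage_comm hQ hp hq
  have hpyp : p ⬝ᵥ y_p = y_p ⬝ᵥ p := dotProduct_comm _ _
  rw [add_mulVec, Matrix.smul_mulVec, vecMulVec_mulVec_eq, mulVec_sub, mulVec_smul, hp, hq, dotProduct_sub,
    dotProduct_smul, hpyq, hpyp, smul_eq_mul, smul_smul]
  have key : 4 * m * (y_p ⬝ᵥ q - 4 * m * (y_p ⬝ᵥ q) / (1 + 4 * m * (y_p ⬝ᵥ p)) * (y_p ⬝ᵥ p))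
      = 4 * m * (y_p ⬝ᵥ q) / (1 + 4 * m * (y_p ⬝ᵥ p)) := by
    field_simp
    ring
  rw [key, sub_add_cancel]

/-- The Sherman–Morrison value: `⟨y, q⟩ = B − 4mC²/(1+4mA)` for the preimage `y` above (`B := ⟨y_q, q⟩`). -/
theorem smPreimage_dotProduct (m : ℝ) (q y_p y_q : ι → ℝ) (A : ℝ) :
    (y_q - (4 * m * (y_p ⬝ᵥ q) / (1 + 4 * m * A)) • y_p) ⬝ᵥ q
      = y_q ⬝ᵥ q - 4 * m * (y_p ⬝ᵥ q) ^ 2 / (1 + 4 * m * A) := by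
  rw [sub_dotProduct, smul_dotProduct, smul_eq_mul]
  ring

/-- `B̃ = ⟨y, Q̃ y⟩ ≥ 0`: the Sherman–Morrison value is the `Q̃`-form of its preimage, hence nonnegative when
`Q ⪰ 0`, `m ≥ 0`. -/
theorem smValue_eq_form (hQ : Q.PosSemidef) (hm : 0 ≤ m) (hp : Q *ᵥ y_p = p) (hq : Q *ᵥ y_q = q) :
    (y_q - (4 * m * (y_p ⬝ᵥ q) / (1 + 4 * m * (y_p ⬝ᵥ p))) • y_p)
        ⬝ᵥ (Q + (4 * m) • vecMulVec p p) *ᵥ (y_q - (4 * m * (y_p ⬝ᵥ q) / (1 + 4 * m * (y_p ⬝ᵥ p))) • y_p)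
      = y_q ⬝ᵥ q - 4 * m * (y_p ⬝ᵥ q) ^ 2 / (1 + 4 * m * (y_p ⬝ᵥ p)) := by
  have hA : 0 ≤ y_p ⬝ᵥ p := by
    have h := form_nonneg hQ y_p
    rwa [hp] at h
  have h1 : 1 + 4 * m * (y_p ⬝ᵥ p) ≠ 0 := by positivity
  rw [plantTilde_mulVec_smPreimage hQ.1 hp hq h1, smPreimage_dotProduct]

/-- `0 ≤ B̃`: the Sherman–Morrison value is nonnegative for `Q ⪰ 0`, `m ≥ 0`. -/
theorem smValue_nonneg (hQ : Q.PosSemidef) (hm : 0 ≤ m) (hp : Q *ᵥ y_p = p) (hq : Q *ᵥ y_q = q) :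
    0 ≤ y_q ⬝ᵥ q - 4 * m * (y_p ⬝ᵥ q) ^ 2 / (1 + 4 * m * (y_p ⬝ᵥ p)) := by
  rw [← smValue_eq_form hQ hm hp hq]
  exact form_nonneg (posSemidef_add_smul_vecMulVec hQ (by positivity) p) _

/-- **Frame lower bound / trial inequality.**  For every trial vector `z`:
`⟨q, z⟩² ≤ B̃ · (zᵀQz + 4m⟨p,z⟩²)` (Cauchy–Schwarz in the `Q̃`-form between the preimage `y` and `z`).  With `z`
ranging over the span of ζ's bottom eigenvectors this is `B̃ ≥ B̃_lo` of FAKES.md §2.10, i.e. `η* ≤ η*_up`. [folklore] -/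
theorem coupling_ge_trial (hQ : Q.PosSemidef) (hm : 0 ≤ m) (hp : Q *ᵥ y_p = p) (hq : Q *ᵥ y_q = q)
    (z : ι → ℝ) :
    (q ⬝ᵥ z) ^ 2 ≤ (y_q ⬝ᵥ q - 4 * m * (y_p ⬝ᵥ q) ^ 2 / (1 + 4 * m * (y_p ⬝ᵥ p)))
        * (z ⬝ᵥ Q *ᵥ z + 4 * m * (p ⬝ᵥ z) ^ 2) := by
  have hA : 0 ≤ y_p ⬝ᵥ p := by
    have h := form_nonneg hQ y_p
    rwa [hp] at h
  have h1 : 1 + 4 * m * (y_p ⬝ᵥ p) ≠ 0 := by positivity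
  have hQt := posSemidef_add_smul_vecMulVec hQ (by positivity : (0:ℝ) ≤ 4 * m) p
  set y := y_q - (4 * m * (y_p ⬝ᵥ q) / (1 + 4 * m * (y_p ⬝ᵥ p))) • y_p with hy_def
  have hy : (Q + (4 * m) • vecMulVec p p) *ᵥ y = q := plantTilde_mulVec_smPreimage hQ.1 hp hq h1
  have hcs := sq_dotProduct_mulVec_le hQt y z
  have e1 : y ⬝ᵥ (Q + (4 * m) • vecMulVec p p) *ᵥ z = q ⬝ᵥ z := by
    rw [dotProduct_mulVec_comm hQt.1 y z, hy, dotProduct_comm]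
  rw [e1, smValue_eq_form hQ hm hp hq, dotProduct_tildeMatrix_mulVec] at hcs
  exact hcs

/-- **Necessity.**  If `Q ⪰ 0`, `m ≥ 0`, `Q y_p = p`, `Q y_q = q` and the planted block is negative at some `x`,
then `1 < 4m B̃ = 4m (B − 4mC²/(1+4mA))`. [folklore] -/
theorem one_lt_coupling_of_plant_neg (hQ : Q.PosSemidef) (hm : 0 ≤ m) (hp : Q *ᵥ y_p = p)
    (hq : Q *ᵥ y_q = q) {x : ι → ℝ}
    (hneg : x ⬝ᵥ Q *ᵥ x + 4 * m * (p ⬝ᵥ x) ^ 2 - 4 * m * (q ⬝ᵥ x) ^ 2 < 0) :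
    1 < 4 * m * (y_q ⬝ᵥ q - 4 * m * (y_p ⬝ᵥ q) ^ 2 / (1 + 4 * m * (y_p ⬝ᵥ p))) := by
  have hcs := coupling_ge_trial hQ hm hp hq x
  have hB := smValue_nonneg hQ hm hp hq
  set Bt := y_q ⬝ᵥ q - 4 * m * (y_p ⬝ᵥ q) ^ 2 / (1 + 4 * m * (y_p ⬝ᵥ p))
  have hform : 0 ≤ x ⬝ᵥ Q *ᵥ x + 4 * m * (p ⬝ᵥ x) ^ 2 := by
    nlinarith [form_nonneg hQ x, sq_nonneg (p ⬝ᵥ x), mul_nonneg hm (sq_nonneg (p ⬝ᵥ x))]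
  by_contra h
  push Not at h
  -- 4m⟨q,x⟩² ≤ 4m·B̃·(xᵀQ̃x) ≤ xᵀQ̃x
  have h2 : 4 * m * (q ⬝ᵥ x) ^ 2 ≤ 4 * m * Bt * (x ⬝ᵥ Q *ᵥ x + 4 * m * (p ⬝ᵥ x) ^ 2) := by
    have := mul_le_mul_of_nonneg_left hcs (by positivity : (0:ℝ) ≤ 4 * m)
    linarith [this]
  have h3 : 4 * m * Bt * (x ⬝ᵥ Q *ᵥ x + 4 * m * (p ⬝ᵥ x) ^ 2)
      ≤ 1 * (x ⬝ᵥ Q *ᵥ x + 4 * m * (p ⬝ᵥ x) ^ 2) := mul_le_mul_of_nonneg_right h hform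
  linarith

/-- **Sufficiency (explicit witness).**  If `1 < 4m B̃` then the planted block is negative at the Sherman–Morrison
preimage `y` (the ONSET MODE of FAKES.md §2.10): `yᵀQy + 4m⟨p,y⟩² − 4m⟨q,y⟩² = B̃ (1 − 4m B̃) < 0`. [folklore] -/
theorem plant_neg_of_one_lt_coupling (hQ : Q.PosSemidef) (hm : 0 ≤ m) (hp : Q *ᵥ y_p = p)
    (hq : Q *ᵥ y_q = q)
    (h : 1 < 4 * m * (y_q ⬝ᵥ q - 4 * m * (y_p ⬝ᵥ q) ^ 2 / (1 + 4 * m * (y_p ⬝ᵥ p)))) :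
    ∃ x : ι → ℝ, x ⬝ᵥ Q *ᵥ x + 4 * m * (p ⬝ᵥ x) ^ 2 - 4 * m * (q ⬝ᵥ x) ^ 2 < 0 := by
  have hA : 0 ≤ y_p ⬝ᵥ p := by
    have h := form_nonneg hQ y_p
    rwa [hp] at h
  have h1 : 1 + 4 * m * (y_p ⬝ᵥ p) ≠ 0 := by positivity
  refine ⟨y_q - (4 * m * (y_p ⬝ᵥ q) / (1 + 4 * m * (y_p ⬝ᵥ p))) • y_p, ?_⟩
  have hqy : q ⬝ᵥ (y_q - (4 * m * (y_p ⬝ᵥ q) / (1 + 4 * m * (y_p ⬝ᵥ p))) • y_p)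
      = y_q ⬝ᵥ q - 4 * m * (y_p ⬝ᵥ q) ^ 2 / (1 + 4 * m * (y_p ⬝ᵥ p)) := by
    rw [dotProduct_comm, smPreimage_dotProduct]
  rw [← dotProduct_tildeMatrix_mulVec, smValue_eq_form hQ hm hp hq, hqy]
  have hB : 0 ≤ y_q ⬝ᵥ q - 4 * m * (y_p ⬝ᵥ q) ^ 2 / (1 + 4 * m * (y_p ⬝ᵥ p)) :=
    smValue_nonneg hQ hm hp hq
  set Bt := y_q ⬝ᵥ q - 4 * m * (y_p ⬝ᵥ q) ^ 2 / (1 + 4 * m * (y_p ⬝ᵥ p))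
  nlinarith

/-- **The plant negativity criterion** (`K1` of FAKES.md §2.10): for `Q ⪰ 0`, `m ≥ 0` and preimages
`Q y_p = p`, `Q y_q = q`,
`(∃ x, xᵀQx + 4m⟨p,x⟩² − 4m⟨q,x⟩² < 0) ↔ 1 < 4m (⟨y_q,q⟩ − 4m⟨y_p,q⟩²/(1 + 4m⟨y_p,p⟩))`. [folklore] -/
theorem plant_neg_iff (hQ : Q.PosSemidef) (hm : 0 ≤ m) (hp : Q *ᵥ y_p = p) (hq : Q *ᵥ y_q = q) :
    (∃ x : ι → ℝ, x ⬝ᵥ Q *ᵥ x + 4 * m * (p ⬝ᵥ x) ^ 2 - 4 * m * (q ⬝ᵥ x) ^ 2 < 0)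
      ↔ 1 < 4 * m * (y_q ⬝ᵥ q - 4 * m * (y_p ⬝ᵥ q) ^ 2 / (1 + 4 * m * (y_p ⬝ᵥ p))) :=
  ⟨fun ⟨_, hx⟩ => one_lt_coupling_of_plant_neg hQ hm hp hq hx,
   fun h => plant_neg_of_one_lt_coupling hQ hm hp hq h⟩

/-- Matrix form of the criterion: the planted block `Q + 4m ppᵀ − 4m qqᵀ` fails to be positive semidefinite as a
form iff `1 < 4m B̃`. -/
theorem plantMatrix_neg_iff (hQ : Q.PosSemidef) (hm : 0 ≤ m) (hp : Q *ᵥ y_p = p) (hq : Q *ᵥ y_q = q) :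
    (∃ x : ι → ℝ, x ⬝ᵥ (Q + (4 * m) • vecMulVec p p - (4 * m) • vecMulVec q q) *ᵥ x < 0)
      ↔ 1 < 4 * m * (y_q ⬝ᵥ q - 4 * m * (y_p ⬝ᵥ q) ^ 2 / (1 + 4 * m * (y_p ⬝ᵥ p))) := by
  simp only [dotProduct_plantMatrix_mulVec]
  exact plant_neg_iff hQ hm hp hq

end ShermanMorrison

section Threshold

variable {Q : Matrix ι ι ℝ} {m : ℝ} {p s y_p y_s : ι → ℝ}

/-- **Threshold in the displacement** (`η*` of FAKES.md §2.10).  In the truncated plant model `q = η s`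
(`s` = off-line deficit direction per unit displacement, preimage `Q y_s = s`), the block is negative somewhere iff
`1 < 4 m η² B̃_s`, `B̃_s := ⟨y_s,s⟩ − 4m⟨y_p,s⟩²/(1 + 4m⟨y_p,p⟩)`; i.e. iff `η² > η*² := 1/(4 m B̃_s)`. [folklore] -/
theorem plant_threshold_iff (hQ : Q.PosSemidef) (hm : 0 ≤ m) (hp : Q *ᵥ y_p = p) (hs : Q *ᵥ y_s = s)
    (η : ℝ) :
    (∃ x : ι → ℝ, x ⬝ᵥ Q *ᵥ x + 4 * m * (p ⬝ᵥ x) ^ 2 - 4 * m * ((η • s) ⬝ᵥ x) ^ 2 < 0)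
      ↔ 1 < 4 * m * η ^ 2 * (y_s ⬝ᵥ s - 4 * m * (y_p ⬝ᵥ s) ^ 2 / (1 + 4 * m * (y_p ⬝ᵥ p))) := by
  have hq : Q *ᵥ (η • y_s) = η • s := by rw [mulVec_smul, hs]
  have h := plant_neg_iff hQ hm hp hq
  rw [h, smul_dotProduct, dotProduct_smul, dotProduct_smul, smul_eq_mul, smul_eq_mul, smul_eq_mul]
  have e : 4 * m * (η * (η * (y_s ⬝ᵥ s)) - 4 * m * (η * (y_p ⬝ᵥ s)) ^ 2 / (1 + 4 * m * (y_p ⬝ᵥ p)))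
      = 4 * m * η ^ 2 * (y_s ⬝ᵥ s - 4 * m * (y_p ⬝ᵥ s) ^ 2 / (1 + 4 * m * (y_p ⬝ᵥ p))) := by
    ring
  rw [e]

/-- Monotonicity of the planted form in the displacement: enlarging `η²` can only lower the form, so negativity at
`η₁` persists at every `η₂` with `η₁² ≤ η₂²` (used with `η ≥ η*_lo(γ; w₀)` in the cross-window Rayleigh–Ritz bound). -/
theorem plant_neg_mono {x : ι → ℝ} {η₁ η₂ : ℝ} (hη : η₁ ^ 2 ≤ η₂ ^ 2) (hm : 0 ≤ m)
    (h : x ⬝ᵥ Q *ᵥ x + 4 * m * (p ⬝ᵥ x) ^ 2 - 4 * m * ((η₁ • s) ⬝ᵥ x) ^ 2 < 0) :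
    x ⬝ᵥ Q *ᵥ x + 4 * m * (p ⬝ᵥ x) ^ 2 - 4 * m * ((η₂ • s) ⬝ᵥ x) ^ 2 < 0 := by
  rw [smul_dotProduct, smul_eq_mul] at h ⊢
  have h0 : 0 ≤ 4 * m * (s ⬝ᵥ x) ^ 2 := by positivity
  nlinarith [mul_le_mul_of_nonneg_left hη h0]

end Threshold

end Summit.RiemannHypothesis.RiemannHypothesis.Theorems.PfPersistenceF2PlantCriterion
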